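import Summits.QuantumFields.YangMills.Theorems.BalabanUVNodesN15KingModelFullPropagatorNE2Operator
import Summits.QuantumFields.YangMills.Theorems.BalabanUVNodesN15KingModelMinimizerNode

/-!
# BalabanUVNodes ∕ N15 — THE KING-MODEL RUNG, CURVED EDITION (PART Q6): «NE2_in_KingModel», FULL-PROPAGATOR EDITION — the K4 by-name
# statement `YMDAG.UVSplit.N15At` at King-model carriers whose OPERATOR layer is the FULL `A = 0` propagator `A₀⁻¹ = G_k(T_ε, 0)` with η-lattice
# test functions (PART Q5), site layer = King's minimiser `ℋ_K` (g2), unit layer = the block-field covariance `(Δ^{(K)})⁻¹` (g0) — ONE family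
# (Track A, DAG node N15 = NE2; FAN-OUT v1.1 §N15 s3 «KING-MODEL RUNG: NE2's analogue DECIDED in the model»)

HONEST FRAMING.  Count-neutral kernel bookkeeping (cell `pub-ymgap`, seat `pub-ymgap-dag-n15-e` g7; `--supports stmt-QuantumFields-20292 --as helper`
= K3⁗ `SpineGivenEndpointR13Sep`).  TEMPLATE LITERATURE, `A = 0`: C. King's scalar U(1)-Higgs MODEL on finite tori ([King1986]); the three kernels
are King's OWN objects — the full fluctuation propagator `G^η_K` of (2.13) ([Ba 4] (1.6) at `A = 0`), the minimiser `ℋ_K` of (2.15) ∕ Prop. 3.8,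
the block-field covariance `(Δ^{(K)})⁻¹` of (4.39)–(4.41); NOT Bałaban's covariant `G_k(U)`, `H_k(U)`, `C^{(k)}(Λ; U)`; `N15At` is the cell's typed
HYPOTHESIS-SHAPE conjunction (`NE2PlusOperator ∧ NE2PlusSite 4 p ∧ NE2PlusUnit`), decided here in the model on ONE-POINT backgrounds; NOT `S_N15`
at the record, NOT a node discharge; nothing continuum ∕ ℝ⁴ ∕ OS ∕ mass-gap ∕ Clay.  0 `sorry`; plumbing defs (`kvIdx`, two `SiteKernel`
wrappers, the `NE2Carriers` bundle); standard axioms.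

THE POINT.  g0 (`n15At_kingModelRung`) and g2 (`n15At_kingModelRungH`) decided `N15At` at the carriers `kingVolInstance` whose test functions
live on the UNIT torus, with the operator layer = the top-scale piece `G^η_{(K)}` read as a two-point kernel.  PART Q5 (`ne2ZeroOperator_fullProp`)
decided the operator layer for the FULL propagator with GENUINE η-lattice test functions on the carrier `etaLatGeo`.  THIS FILE re-bundles: along
the index map `kvIdx : KingVolIndex ↦ EtaLatIdx` (cube `2L^m`, `K` levels, scale shift `n = 1`, mass `m²`) the King-volume site ∕ unit kernels of
g2 ∕ g0 (`kingHStep`, `blockCovStep` — their site sort `Tor (2L^m)` IS `etaLatGeo`'s) are read on PART Q5's carriers, so that ALL THREE layers sit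
on ONE paired-instance family:
* §1 `kvIdx`, `kingHSiteEta`, `blockCovUnitEta`, `etaUnitDist`; `ne2PlusOperator_fullProp_kv` (PART Q5 restricted along `kvIdx`),
  `etaRateIneqSite_kingH_eta` ∕ `ne2PlusSite_kingH_eta` (g2 `kingHStep_le` on the new carrier: `len = 1`, `dist = tdistT`),
  `etaRateIneqUnit_blockCov_eta` ∕ `ne2PlusUnit_blockCov_eta` (g0 `blockCov_step_le`, `θ = L⁻¹`);
* §2 `fullPropCarriersEta : NE2Carriers` (`d + 1 = 4`), ★★ **`n15At_fullPropEta : N15At (fullPropCarriersEta L a m² hm c35 p)`**, index inhabited.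
WHAT THE CURVED CASE ADDS (one line): the same conjunction for Bałaban's `G_k(U)` ∕ `H_k(U)` ∕ `C^{(k)}(Λ;U)` on the multiscale `𝔅`, uniformly
over the LIVE window `Reg335 ∕ Reg336` (print: analyticity in `U`, [B9] Thm 3.4, and η-uniformity — never an η-difference); at the record the node
is `S_N15 RRec` on NODE 00's carriers, not these.
HONEST SCOPE.  (i) `A = 0`, periodic b.c., odd `L ≥ 3`, `a, m² > 0`, cubes `2L^m`, `K ≥ 1`, `n = 1` in the bundle (PART Q5's operator layer holds
for every `n ≥ 1` and every mass `≤ m₀²`; the bundle fixes `n = 1`, `m²` to share g0∕g2's index); (ii) `d + 1 = 4`; (iii) one-point backgrounds;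
(iv) rate exponents: operator `γ = 1∕4`, site `γ′∕2`, unit `θ = L⁻¹`; not a discharge.
Locators: [King1986] C. King, CMP **102** (1986) 649–677: (2.13)–(2.15) p. 653, Theorem 3.3 (3.7) p. 658, Prop. 3.8 (3.71) p. 664, (4.39)–(4.41)
pp. 674–675; [Ba 4] = [Balaban1983RegularityDecay] (1.6) p. 572; [B9] = [Balaban1985BackgroundPropagators] Thm 3.1 (3.42) p. 397, Thm 3.2 (3.48)
p. 398, (3.133) p. 422, Thm 3.15 (3.187) p. 432 (quantifier templates), Thm 3.4 p. 400.
-/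

noncomputable section

namespace Summit.QuantumFields.YangMills.BalabanUVNodes.N15KingModelRung.Curved

open Real Finset
open Literature.MathematicalPhysics.QuantumFieldTheory.Balaban1983to89
open Literature.MathematicalPhysics.QuantumFieldTheory.Balaban1983to89.T4EtaRate (PairedInstance EtaRateIneq342 EtaRateIneqSite EtaRateIneqUnit
  NE2PlusOperator NE2PlusSite NE2PlusUnit rateFactor)
open Literature.MathematicalPhysics.QuantumFieldTheory.Balaban1983to89.T4EtaRateDefectSite (pt9Bg)
open Literature.MathematicalPhysics.QuantumFieldTheory.Balaban1983to89.B5Prop11Plancherel (Tor fine)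
open Literature.MathematicalPhysics.QuantumFieldTheory.King1986 (aK)
open Literature.MathematicalPhysics.QuantumFieldTheory.King1986.Torus (tdistT CdiffM kapM CdiffM_nonneg kapM_pos_le)
open YMDAG.UVSplit (NE2Carriers N15At)

variable {d : ℕ} (L : ℕ) [NeZero L]

/-! ## §1 The three layers on PART Q5's carriers along the King-volume index -/

/-- The index map: King-volume index `(m, K, Msz)` ↦ PART Q5's index at scale shift `n = 1` and mass `m²` (cube `2L^m`). [folklore] -/
def kvIdx {m2 : ℝ} (hm : 0 < m2) (j : KingVolIndex d) : EtaLatIdx d m2 :=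
  ⟨j.m, j.K, j.one_le_K, 1, le_rfl, m2, hm, le_rfl, j.Msz, j.one_le_Msz⟩

/-- King's H-kernel sup entries (g2 `kingHStep`: `sup_{B(x′) = y}|ℋ_{K+1}(x′, b) − ℋ_K(x, b)|`) as the SITE kernel on PART Q5's carrier (same site
sort `Tor (2L^m)`). [cite: Balaban1985BackgroundPropagators, (3.133) p.422 (sup-entry shape); King1986, Prop. 3.8 (3.71) p.664 (object)] -/
def kingHSiteEta (a : ℝ) {m2 : ℝ} (hm : 0 < m2) :
    ∀ j : KingVolIndex d, B9.SiteKernel (etaLatInstance d L m2 (kvIdx hm j)).gc (etaLatInstance d L m2 (kvIdx hm j)).Bf :=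
  fun j => ⟨fun _ y b => kingHStep L a m2 j y b⟩

/-- The block-field covariance's η-difference (g0 `blockCovStep`: `(Δ^{(K+1)})⁻¹(b, b′) − (Δ^{(K)})⁻¹(b, b′)`) as the UNIT-LAYER kernel on PART Q5's
carrier. [cite: Balaban1985BackgroundPropagators, Thm 3.15 (3.187) p.432 (shape); King1986, (4.41) p.675 (object)] -/
def blockCovUnitEta (a : ℝ) {m2 : ℝ} (hm : 0 < m2) :
    ∀ j : KingVolIndex d, B9.SiteKernel (etaLatInstance d L m2 (kvIdx hm j)).gc (etaLatInstance d L m2 (kvIdx hm j)).Bf :=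
  fun j => ⟨fun _ b b' => blockCovStep L a m2 j b b'⟩

/-- `unitDist :=` the carrier's distance = King's unit-torus block distance `tdistT`. [cite: King1986, Lemma 4.5 (4.38) p.674 (the distance |x − y|)] -/
def etaUnitDist {m2 : ℝ} (hm : 0 < m2) :
    ∀ j : KingVolIndex d, (etaLatInstance d L m2 (kvIdx hm j)).gc.Site → (etaLatInstance d L m2 (kvIdx hm j)).gc.Site → ℝ :=
  fun j y y' => (etaLatInstance d L m2 (kvIdx hm j)).gc.dist y y'

/-- **OPERATOR LAYER: PART Q5 restricted along `kvIdx`** — `NE2PlusOperator` for the full `A = 0` propagator with η-lattice test functions on the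
sub-family `n = 1`, mass `m²` (every `c35`; one-point backgrounds). [cite: Balaban1985BackgroundPropagators, Thm 3.1 (3.42) p.397 (quantifier template); King1986, Theorem 3.3 (3.7) p.658, Prop. 3.8 (3.71) p.664] -/
theorem ne2PlusOperator_fullProp_kv (hLodd : Odd L) (hL : 2 ≤ L) {a : ℝ} (ha : 0 < a) {m2 : ℝ} (hm : 0 < m2) (c35 : ℝ) :
    NE2PlusOperator c35 (fun j : KingVolIndex d => etaLatInstance d L m2 (kvIdx hm j))
      (fun j => etaLatKF d L a m2 (kvIdx hm j)) := by
  obtain ⟨B₀, δ, hB₀, hδ, H⟩ := etaRateIneq342_fullProp (d := d) L hLodd hL ha hm.le (γ := 1 / 4) (by norm_num) (by norm_num)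
  exact ⟨1, δ, 1, B₀, 1 / 4, one_pos, hδ, one_pos, hB₀, by norm_num, fun j _ _ _ _ U _ => H (kvIdx hm j)⟩

/-- **THE TYPED SITE INEQUALITY FOR KING'S H-KERNEL ON THE NEW CARRIER, UNIFORMLY** (`0 < γ ≤ 1`, rate `γ∕2`; `len = 1`, `dist = tdistT`; g2
`kingHStep_le`). [cite: Balaban1985BackgroundPropagators, (3.133) p.422 (shape) + Thm 3.14 pp.426–427 (template); King1986, Prop. 3.8 (3.71) p.664] -/
theorem etaRateIneqSite_kingH_eta (hLodd : Odd L) (hL : 2 ≤ L) {a m2 : ℝ} (ha : 0 < a) (hm : 0 < m2) {γ : ℝ} (hγ0 : 0 < γ)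
    (hγ1 : γ ≤ 1) :
    ∃ C δ : ℝ, 0 < C ∧ 0 < δ ∧ ∀ (j : KingVolIndex d) (U : (etaLatInstance d L m2 (kvIdx hm j)).Bf.Cfg) (d' : ℕ) (p : ℝ),
      EtaRateIneqSite d' p (kingHSiteEta L a hm j) C δ (γ / 2) U := by
  obtain ⟨C, δ, hC, hδ, H⟩ := kingHStep_le (d := d) L hLodd hL ha hm hγ0.le hγ1
  refine ⟨C, δ, hC, hδ, fun j U d' p y y' => ?_⟩
  have hL0 : (0 : ℝ) < L := by exact_mod_cast Nat.pos_of_ne_zero (NeZero.ne L)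
  show |kingHStep L a m2 j y y'| ≤
    C * (etaLatGeo d (L : ℝ) j.Msz j.K (L ^ j.K) (EtaLatIdx.cube L (kvIdx hm j))).len y ^ (-p) *
      (etaLatGeo d (L : ℝ) j.Msz j.K (L ^ j.K) (EtaLatIdx.cube L (kvIdx hm j))).len y' ^ (-(d' : ℝ)) *
      Real.exp (-(δ * tdistT (EtaLatIdx.cube L (kvIdx hm j)) y y')) *
      max (rateFactor (etaLatGeo d (L : ℝ) j.Msz j.K (L ^ j.K) (EtaLatIdx.cube L (kvIdx hm j))) (γ / 2) y)
        (rateFactor (etaLatGeo d (L : ℝ) j.Msz j.K (L ^ j.K) (EtaLatIdx.cube L (kvIdx hm j))) (γ / 2) y')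
  rw [etaLatGeo_len _ _ _ _ _ hL0.ne', etaLatGeo_len _ _ _ _ _ hL0.ne', Real.one_rpow, Real.one_rpow, mul_one, mul_one,
    rateFactor_etaLatGeo _ _ _ _ _ hL0, rateFactor_etaLatGeo _ _ _ _ _ hL0, max_self, abs_of_nonneg (kingHStep_nonneg L a m2 j y y')]
  exact H j y y'

/-- **`NE2PlusSite` FOR KING'S H-KERNEL ON THE NEW CARRIER, HYPOTHESIS-FREE** (odd `L ≥ 3`, `a, m² > 0`, `0 < γ ≤ 1`; every `d′, p, c35`):
`(M₅, δ, a₀, C, γ) = (1, δ, 1, C, γ∕2)`. [cite: Balaban1985BackgroundPropagators, Thm 3.2 (3.48) p.398 + (3.133) p.422 (quantifier template); King1986, Prop. 3.8 (3.71) p.664] -/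
theorem ne2PlusSite_kingH_eta (hLodd : Odd L) (hL : 2 ≤ L) {a m2 : ℝ} (ha : 0 < a) (hm : 0 < m2) {γ : ℝ} (hγ0 : 0 < γ)
    (hγ1 : γ ≤ 1) (d' : ℕ) (p c35 : ℝ) :
    NE2PlusSite d' p c35 (fun j : KingVolIndex d => etaLatInstance d L m2 (kvIdx hm j)) (kingHSiteEta L a hm) := by
  obtain ⟨C, δ, hC, hδ, H⟩ := etaRateIneqSite_kingH_eta (d := d) L hLodd hL ha hm hγ0 hγ1
  exact ⟨1, δ, 1, C, γ / 2, one_pos, hδ, one_pos, hC, half_pos hγ0, fun j _ _ _ _ U _ => H j U d' p⟩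

/-- **THE TYPED UNIT INEQUALITY FOR THE BLOCK-FIELD COVARIANCE ON THE NEW CARRIER, UNIFORMLY** (`L ≥ 2`, `a, m² > 0`): constants `(C_diff + 1,
κ_M∕2)`, rate `θ = L⁻¹` (g0 `blockCov_step_le`). [cite: Balaban1985BackgroundPropagators, Thm 3.15 (3.187) p.432 (shape); King1986, (4.41) p.675] -/
theorem etaRateIneqUnit_blockCov_eta (hL : 2 ≤ L) {a m2 : ℝ} (ha : 0 < a) (hm : 0 < m2) (j : KingVolIndex d)
    (U : (etaLatInstance d L m2 (kvIdx hm j)).Bf.Cfg) :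
    EtaRateIneqUnit (blockCovUnitEta L a hm j) (fun _ => True) (etaUnitDist L hm j) (CdiffM (d + 1) a m2 L + 1)
      (kapM (d + 1) a m2 L / 2) ((L : ℝ)⁻¹) j.K U := by
  intro y y' _ _
  have h := blockCov_step_le (d := d) L hL ha hm j y y'
  have hLK : 0 ≤ ((L : ℝ) ^ j.K)⁻¹ := by positivity
  show |blockCovStep L a m2 j y y'| ≤
    (CdiffM (d + 1) a m2 L + 1) * Real.exp (-(kapM (d + 1) a m2 L / 2 * tdistT (EtaLatIdx.cube L (kvIdx hm j)) y y')) * ((L : ℝ)⁻¹) ^ j.K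
  rw [inv_pow]
  calc |blockCovStep L a m2 j y y'|
      ≤ CdiffM (d + 1) a m2 L * ((L : ℝ) ^ j.K)⁻¹ * Real.exp (-(kapM (d + 1) a m2 L / 2 * tdistT (EtaLatIdx.cube L (kvIdx hm j)) y y')) := h
    _ ≤ (CdiffM (d + 1) a m2 L + 1) * ((L : ℝ) ^ j.K)⁻¹ * Real.exp (-(kapM (d + 1) a m2 L / 2 * tdistT (EtaLatIdx.cube L (kvIdx hm j)) y y')) := by
        gcongr
        linarith
    _ = (CdiffM (d + 1) a m2 L + 1) * Real.exp (-(kapM (d + 1) a m2 L / 2 * tdistT (EtaLatIdx.cube L (kvIdx hm j)) y y')) * ((L : ℝ) ^ j.K)⁻¹ := by ring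

/-- **`NE2PlusUnit` FOR THE BLOCK-FIELD COVARIANCE ON THE NEW CARRIER, HYPOTHESIS-FREE** (`L ≥ 2`, `a, m² > 0`, every `c35`):
`(δ₀, a₀, B₀, θ) = (κ_M∕2, 1, C_diff + 1, L⁻¹)`. [cite: Balaban1985BackgroundPropagators, Thm 3.15 (3.187) p.432 (quantifier template); King1986, (4.39)–(4.41) pp.674–675] -/
theorem ne2PlusUnit_blockCov_eta (hL : 2 ≤ L) {a m2 : ℝ} (ha : 0 < a) (hm : 0 < m2) (c35 : ℝ) :
    NE2PlusUnit c35 (fun j : KingVolIndex d => etaLatInstance d L m2 (kvIdx hm j)) (blockCovUnitEta L a hm) (fun _ _ => True)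
      (etaUnitDist L hm) := by
  have hLpos : (0 : ℝ) < L := by exact_mod_cast (lt_of_lt_of_le zero_lt_two hL)
  have hθ1 : (L : ℝ)⁻¹ < 1 := inv_lt_one_of_one_lt₀ (by exact_mod_cast hL)
  have hC : 0 < CdiffM (d + 1) a m2 L + 1 := by linarith [CdiffM_nonneg (d := d + 1) ha hm hL]
  exact ⟨kapM (d + 1) a m2 L / 2, 1, CdiffM (d + 1) a m2 L + 1, (L : ℝ)⁻¹, half_pos (kapM_pos_le ha hm hL).1, one_pos, hC,
    inv_pos.mpr hLpos, hθ1, fun j _ _ _ U _ _ => etaRateIneqUnit_blockCov_eta L hL ha hm j U⟩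

/-! ## §2 The bundle and `N15At` -/

/-- THE KING-MODEL CARRIER BUNDLE, FULL-PROPAGATOR EDITION (`YMDAG.UVSplit.NE2Carriers`, `d + 1 = 4`): index `KingVolIndex 3`, paired instances
= PART Q5's `etaLatInstance` along `kvIdx` (η-lattice test functions), **operator family = the FULL `A = 0` propagator's four (3.42) entries**
(`etaLatKF`), site kernels = King's H-kernel, unit kernels = the block-field covariance, `inΛ := True`, `unitDist := tdistT`.  NOT the carriers
of record (NODE 00's); no `RRec` instantiated. [cite: King1986, (2.13)–(2.15) p.653, Prop. 3.8 p.664, (4.41) p.675 (objects)] -/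
def fullPropCarriersEta (a m2 : ℝ) (hm : 0 < m2) (c35 p : ℝ) : NE2Carriers where
  I := KingVolIndex 3
  c35 := c35
  p := p
  pi := fun j => etaLatInstance 3 L m2 (kvIdx hm j)
  Kop := fun j => etaLatKF 3 L a m2 (kvIdx hm j)
  Ksite := kingHSiteEta L a hm
  Kunit := blockCovUnitEta L a hm
  inΛ := fun _ _ => True
  unitDist := etaUnitDist L hm

/-- ★★ **«NE2_in_KingModel», FULL-PROPAGATOR EDITION: THE K4 BY-NAME STATEMENT `N15At` HOLDS AT THE KING-MODEL CARRIERS WHOSE OPERATOR LAYER IS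
THE FULL `A = 0` PROPAGATOR WITH η-LATTICE TEST FUNCTIONS, HYPOTHESIS-FREE** (odd `L ≥ 3`, `a, m² > 0`, `0 < γ ≤ 1`, every `c35`, `p`; `d + 1 = 4`):
`NE2PlusOperator` (PART Q5) ∧ `NE2PlusSite 4 p` (King's `ℋ_K`, g2) ∧ `NE2PlusUnit` (`(Δ^{(K)})⁻¹`, g0) on ONE family.  NOT `S_N15 RRec`, NOT a
discharge. [cite: King1986, Theorem 3.3 (3.7) p.658, Prop. 3.8 (3.71) p.664, (4.41) p.675; Balaban1985BackgroundPropagators, Thm 3.1 (3.42) p.397 + (3.133) p.422 + Thm 3.15 (3.187) p.432 (quantifier templates)] -/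
theorem n15At_fullPropEta (hLodd : Odd L) (hL : 2 ≤ L) {a m2 : ℝ} (ha : 0 < a) (hm : 0 < m2) {γ : ℝ} (hγ0 : 0 < γ) (hγ1 : γ ≤ 1)
    (c35 p : ℝ) : N15At (fullPropCarriersEta L a m2 hm c35 p) :=
  ⟨ne2PlusOperator_fullProp_kv (d := 3) L hLodd hL ha hm c35, ne2PlusSite_kingH_eta (d := 3) L hLodd hL ha hm hγ0 hγ1 4 p c35,
    ne2PlusUnit_blockCov_eta (d := 3) L hL ha hm c35⟩

/-- The bundle's index type is inhabited (not the empty-index trap). [folklore] -/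
theorem fullPropCarriersEta_index_nonempty (a m2 : ℝ) (hm : 0 < m2) (c35 p : ℝ) : Nonempty (fullPropCarriersEta L a m2 hm c35 p).I :=
  kingVolIndex_nonempty 3

end Summit.QuantumFields.YangMills.BalabanUVNodes.N15KingModelRung.Curved
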